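import Mathlib
import HarnessLib
import Literature.MathematicalPhysics.QuantumLattice.KohnLuttinger
import Literature.Computability.MetaComplexity.TaylorCosineMinorants
import Summits.HubbardSuperconductivity.HubbardSuperconductivity.Theorems.ChiralWindowCwKLChiralWindowMuWindow
import Summits.HubbardSuperconductivity.HubbardSuperconductivity.Theorems.KLProgrammeMuOfDopingWindowConvex

/-!
# Route `KLProgramme` — support item `MuOfDopingWindow` (stmt-HubbardSuperconductivity-19939):
# the certified lower filling bound `n(-3/20) ≥ 9/10`

For the nearest-neighbour band `ε₀ = squareDispersion 1 0` the filling is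
`n(μ) = 2 vol({ε₀ < μ} ∩ BZ) / (2π)²` (`kl_mu_filling_eq`).  The upper end `-0.15 = -3/20` of the analysis
window of item `MuOfDopingWindow` needs `n(-3/20) ≥ 9/10` (true value `0.9138`, margin `1.5 %`), i.e.
`vol({cos x + cos y > 3/40} ∩ BZ) ≥ 1.8 π² = 17.7653`.  We inscribe a `D₄`-symmetric 24-gon in the (convex,
`convex_fermiSeaCoord`) Fermi sea `R = {|x+y| < π, |x-y| < π, cos x + cos y > 3/40}`: its vertices are the
images of `(0, 2.749)`, `(0.3, 2.645)`, `(0.75, 2.285)`, `(1.532, 1.532)` under the symmetries, certified to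
lie in `R` by the degree-`10` Taylor minorant of `cos` (`taylor_ten_le_cos`, from the tree's all-orders
`cosTaylorSum_le_cos`), and it is the disjoint union of `12` symmetric trapezoids over consecutive
`x`-intervals (`trapezoid_subset_of_convex`, `volume_trapezoid`, `trapezoid_union_step`) of total area
`447457/25000 = 17.89828 > 1.8 π²` (`π < 3.1416`).  Hence `muWinL_filling_ge : 9/10 ≤ n(-3/20)`.
Folklore; no definitions.
-/

noncomputable section

set_option linter.dupNamespace false

namespace Summit.HubbardSuperconductivity.HubbardSuperconductivity.Theorems

open MeasureTheory Set Literature.MathematicalPhysics.QuantumLattice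

/-! ### Certified cosines -/

/-- The degree-`10` Taylor minorant of the cosine, valid on all of `ℝ` (the tree's `cosTaylorSum_le_cos`
at `M = 5`). [folklore] -/
theorem taylor_ten_le_cos (y : ℝ) :
    1 - y ^ 2 / 2 + y ^ 4 / 24 - y ^ 6 / 720 + y ^ 8 / 40320 - y ^ 10 / 3628800 ≤ Real.cos y := by
  have h := Literature.Computability.MetaComplexity.cosTaylorSum_le_cos (M := 5) (by decide) y
  simp only [Finset.sum_range_succ, Finset.sum_range_zero] at h
  norm_num [Nat.factorial] at h
  linarith

/-- Vertex `(0, 2.749)` of the inscribed polygon lies in the Fermi sea at `c = 3/40`. [folklore] -/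
theorem muWinL_vertex_a :
    ((0 : ℝ), (2749 / 1000 : ℝ)) ∈ {q : ℝ × ℝ | |q.1 + q.2| < Real.pi ∧ |q.1 - q.2| < Real.pi ∧
      3 / 40 < Real.cos q.1 + Real.cos q.2} := by
  refine mem_fermiSeaCoord ?_ ?_
  · rw [abs_of_nonneg (by norm_num), abs_of_nonneg (by norm_num)]; linarith [Real.pi_gt_d2]
  · have h2 := taylor_ten_le_cos (2749 / 1000 : ℝ)
    rw [Real.cos_zero]
    norm_num at h2 ⊢
    linarith

/-- Vertex `(0.3, 2.645)` of the inscribed polygon lies in the Fermi sea at `c = 3/40`. [folklore] -/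
theorem muWinL_vertex_b :
    ((3 / 10 : ℝ), (529 / 200 : ℝ)) ∈ {q : ℝ × ℝ | |q.1 + q.2| < Real.pi ∧ |q.1 - q.2| < Real.pi ∧
      3 / 40 < Real.cos q.1 + Real.cos q.2} := by
  refine mem_fermiSeaCoord ?_ ?_
  · rw [abs_of_nonneg (by norm_num), abs_of_nonneg (by norm_num)]; linarith [Real.pi_gt_d2]
  · have h1 := taylor_ten_le_cos (3 / 10 : ℝ)
    have h2 := taylor_ten_le_cos (529 / 200 : ℝ)
    norm_num at h1 h2 ⊢
    linarith

/-- Vertex `(0.75, 2.285)` of the inscribed polygon lies in the Fermi sea at `c = 3/40`. [folklore] -/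
theorem muWinL_vertex_c :
    ((3 / 4 : ℝ), (457 / 200 : ℝ)) ∈ {q : ℝ × ℝ | |q.1 + q.2| < Real.pi ∧ |q.1 - q.2| < Real.pi ∧
      3 / 40 < Real.cos q.1 + Real.cos q.2} := by
  refine mem_fermiSeaCoord ?_ ?_
  · rw [abs_of_nonneg (by norm_num), abs_of_nonneg (by norm_num)]; linarith [Real.pi_gt_d2]
  · have h1 := taylor_ten_le_cos (3 / 4 : ℝ)
    have h2 := taylor_ten_le_cos (457 / 200 : ℝ)
    norm_num at h1 h2 ⊢
    linarith

/-- The diagonal vertex `(1.532, 1.532)` of the inscribed polygon lies in the Fermi sea at `c = 3/40`.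
[folklore] -/
theorem muWinL_vertex_d :
    ((383 / 250 : ℝ), (383 / 250 : ℝ)) ∈ {q : ℝ × ℝ | |q.1 + q.2| < Real.pi ∧ |q.1 - q.2| < Real.pi ∧
      3 / 40 < Real.cos q.1 + Real.cos q.2} := by
  refine mem_fermiSeaCoord ?_ ?_
  · rw [abs_of_nonneg (by norm_num)]; linarith [Real.pi_gt_d2]
  · have h1 := taylor_ten_le_cos (383 / 250 : ℝ)
    norm_num at h1 ⊢
    linarith

/-! ### The inscribed 24-gon: twelve trapezoids -/

/-- **The inscribed polygon**: the Fermi sea `{|x+y| < π, |x-y| < π, cos x + cos y > 3/40}` has area at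
least `447457/25000 = 17.89828` (twelve symmetric trapezoids over the `x`-intervals between the nodes
`∓2.749, ∓2.645, ∓2.285, ∓1.532, ∓0.75, ∓0.3, 0`, inscribed by convexity). [folklore] -/
theorem muWinL_le_volume_fermiSeaCoord :
    ENNReal.ofReal (447457 / 25000) ≤ volume {q : ℝ × ℝ | |q.1 + q.2| < Real.pi ∧
      |q.1 - q.2| < Real.pi ∧ 3 / 40 < Real.cos q.1 + Real.cos q.2} := by
  have hconv := convex_fermiSeaCoord (show (0 : ℝ) < 3 / 40 by norm_num)
  -- the 26 corners `(tₖ, ±hₖ)`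
  have m0 := fermiSeaCoord_neg_fst (fermiSeaCoord_swap muWinL_vertex_a)
  have n0 := fermiSeaCoord_neg_snd m0
  have m1 := fermiSeaCoord_neg_fst (fermiSeaCoord_swap muWinL_vertex_b)
  have n1 := fermiSeaCoord_neg_snd m1
  have m2 := fermiSeaCoord_neg_fst (fermiSeaCoord_swap muWinL_vertex_c)
  have n2 := fermiSeaCoord_neg_snd m2
  have m3 := fermiSeaCoord_neg_fst muWinL_vertex_d
  have n3 := fermiSeaCoord_neg_snd m3
  have m4 := fermiSeaCoord_neg_fst muWinL_vertex_c
  have n4 := fermiSeaCoord_neg_snd m4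
  have m5 := fermiSeaCoord_neg_fst muWinL_vertex_b
  have n5 := fermiSeaCoord_neg_snd m5
  have m6 := muWinL_vertex_a
  have n6 := fermiSeaCoord_neg_snd m6
  have m7 := muWinL_vertex_b
  have n7 := fermiSeaCoord_neg_snd m7
  have m8 := muWinL_vertex_c
  have n8 := fermiSeaCoord_neg_snd m8
  have m9 := muWinL_vertex_d
  have n9 := fermiSeaCoord_neg_snd m9
  have m10 := fermiSeaCoord_swap muWinL_vertex_c
  have n10 := fermiSeaCoord_neg_snd m10
  have m11 := fermiSeaCoord_swap muWinL_vertex_b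
  have n11 := fermiSeaCoord_neg_snd m11
  have m12 := fermiSeaCoord_swap muWinL_vertex_a
  have n12 := fermiSeaCoord_neg_snd m12
  -- piece 1: x ∈ (-(2749/1000), -(529/200)], area 39/1250
  have hP1 := trapezoid_subset_of_convex hconv (by norm_num) m0 n0 m1 n1
  have hV1 := volume_trapezoid (x₀ := -(2749/1000)) (x₁ := -(529/200)) (y₀ := 0) (y₁ := 3/10)
    (by norm_num) (by norm_num) (by norm_num)
  -- piece 2: x ∈ (-(529/200), -(457/200)], area 189/500
  have hP2 := trapezoid_subset_of_convex hconv (by norm_num) m1 n1 m2 n2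
  have hV2 := volume_trapezoid (x₀ := -(529/200)) (x₁ := -(457/200)) (y₀ := 3/10) (y₁ := 3/4)
    (by norm_num) (by norm_num) (by norm_num)
  -- piece 3: x ∈ (-(457/200), -(383/250)], area 859173/500000
  have hP3 := trapezoid_subset_of_convex hconv (by norm_num) m2 n2 m3 n3
  have hV3 := volume_trapezoid (x₀ := -(457/200)) (x₁ := -(383/250)) (y₀ := 3/4) (y₁ := 383/250)
    (by norm_num) (by norm_num) (by norm_num)
  -- piece 4: x ∈ (-(383/250), -(3/4)], area 1492447/500000
  have hP4 := trapezoid_subset_of_convex hconv (by norm_num) m3 n3 m4 n4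
  have hV4 := volume_trapezoid (x₀ := -(383/250)) (x₁ := -(3/4)) (y₀ := 383/250) (y₁ := 457/200)
    (by norm_num) (by norm_num) (by norm_num)
  -- piece 5: x ∈ (-(3/4), -(3/10)], area 4437/2000
  have hP5 := trapezoid_subset_of_convex hconv (by norm_num) m4 n4 m5 n5
  have hV5 := volume_trapezoid (x₀ := -(3/4)) (x₁ := -(3/10)) (y₀ := 457/200) (y₁ := 529/200)
    (by norm_num) (by norm_num) (by norm_num)
  -- piece 6: x ∈ (-(3/10), 0], area 8091/5000
  have hP6 := trapezoid_subset_of_convex hconv (by norm_num) m5 n5 m6 n6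
  have hV6 := volume_trapezoid (x₀ := -(3/10)) (x₁ := 0) (y₀ := 529/200) (y₁ := 2749/1000)
    (by norm_num) (by norm_num) (by norm_num)
  -- piece 7: x ∈ (0, 3/10], area 8091/5000
  have hP7 := trapezoid_subset_of_convex hconv (by norm_num) m6 n6 m7 n7
  have hV7 := volume_trapezoid (x₀ := 0) (x₁ := 3/10) (y₀ := 2749/1000) (y₁ := 529/200)
    (by norm_num) (by norm_num) (by norm_num)
  -- piece 8: x ∈ (3/10, 3/4], area 4437/2000
  have hP8 := trapezoid_subset_of_convex hconv (by norm_num) m7 n7 m8 n8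
  have hV8 := volume_trapezoid (x₀ := 3/10) (x₁ := 3/4) (y₀ := 529/200) (y₁ := 457/200)
    (by norm_num) (by norm_num) (by norm_num)
  -- piece 9: x ∈ (3/4, 383/250], area 1492447/500000
  have hP9 := trapezoid_subset_of_convex hconv (by norm_num) m8 n8 m9 n9
  have hV9 := volume_trapezoid (x₀ := 3/4) (x₁ := 383/250) (y₀ := 457/200) (y₁ := 383/250)
    (by norm_num) (by norm_num) (by norm_num)
  -- piece 10: x ∈ (383/250, 457/200], area 859173/500000
  have hP10 := trapezoid_subset_of_convex hconv (by norm_num) m9 n9 m10 n10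
  have hV10 := volume_trapezoid (x₀ := 383/250) (x₁ := 457/200) (y₀ := 383/250) (y₁ := 3/4)
    (by norm_num) (by norm_num) (by norm_num)
  -- piece 11: x ∈ (457/200, 529/200], area 189/500
  have hP11 := trapezoid_subset_of_convex hconv (by norm_num) m10 n10 m11 n11
  have hV11 := volume_trapezoid (x₀ := 457/200) (x₁ := 529/200) (y₀ := 3/4) (y₁ := 3/10)
    (by norm_num) (by norm_num) (by norm_num)
  -- piece 12: x ∈ (529/200, 2749/1000], area 39/1250
  have hP12 := trapezoid_subset_of_convex hconv (by norm_num) m11 n11 m12 n12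
  have hV12 := volume_trapezoid (x₀ := 529/200) (x₁ := 2749/1000) (y₀ := 3/10) (y₁ := 0)
    (by norm_num) (by norm_num) (by norm_num)
  -- disjoint union, left to right
  have hU := trapezoid_union_step (U := (∅ : Set (ℝ × ℝ))) (s := -(2749/1000)) (Set.empty_subset _)
    (Set.empty_subset _) (by rw [measure_empty, ENNReal.ofReal_zero]) le_rfl hP1
    (regionBetween_subset _ _ _) (measurableSet_trapezoid _ _ _ _) hV1 (by norm_num) (by norm_num)
  have hU := trapezoid_union_step hU.1 hU.2.1 hU.2.2.1 hU.2.2.2 hP2 (regionBetween_subset _ _ _)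
    (measurableSet_trapezoid _ _ _ _) hV2 (by norm_num) (by norm_num)
  have hU := trapezoid_union_step hU.1 hU.2.1 hU.2.2.1 hU.2.2.2 hP3 (regionBetween_subset _ _ _)
    (measurableSet_trapezoid _ _ _ _) hV3 (by norm_num) (by norm_num)
  have hU := trapezoid_union_step hU.1 hU.2.1 hU.2.2.1 hU.2.2.2 hP4 (regionBetween_subset _ _ _)
    (measurableSet_trapezoid _ _ _ _) hV4 (by norm_num) (by norm_num)
  have hU := trapezoid_union_step hU.1 hU.2.1 hU.2.2.1 hU.2.2.2 hP5 (regionBetween_subset _ _ _)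
    (measurableSet_trapezoid _ _ _ _) hV5 (by norm_num) (by norm_num)
  have hU := trapezoid_union_step hU.1 hU.2.1 hU.2.2.1 hU.2.2.2 hP6 (regionBetween_subset _ _ _)
    (measurableSet_trapezoid _ _ _ _) hV6 (by norm_num) (by norm_num)
  have hU := trapezoid_union_step hU.1 hU.2.1 hU.2.2.1 hU.2.2.2 hP7 (regionBetween_subset _ _ _)
    (measurableSet_trapezoid _ _ _ _) hV7 (by norm_num) (by norm_num)
  have hU := trapezoid_union_step hU.1 hU.2.1 hU.2.2.1 hU.2.2.2 hP8 (regionBetween_subset _ _ _)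
    (measurableSet_trapezoid _ _ _ _) hV8 (by norm_num) (by norm_num)
  have hU := trapezoid_union_step hU.1 hU.2.1 hU.2.2.1 hU.2.2.2 hP9 (regionBetween_subset _ _ _)
    (measurableSet_trapezoid _ _ _ _) hV9 (by norm_num) (by norm_num)
  have hU := trapezoid_union_step hU.1 hU.2.1 hU.2.2.1 hU.2.2.2 hP10 (regionBetween_subset _ _ _)
    (measurableSet_trapezoid _ _ _ _) hV10 (by norm_num) (by norm_num)
  have hU := trapezoid_union_step hU.1 hU.2.1 hU.2.2.1 hU.2.2.2 hP11 (regionBetween_subset _ _ _)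
    (measurableSet_trapezoid _ _ _ _) hV11 (by norm_num) (by norm_num)
  have hU := trapezoid_union_step hU.1 hU.2.1 hU.2.2.1 hU.2.2.2 hP12 (regionBetween_subset _ _ _)
    (measurableSet_trapezoid _ _ _ _) hV12 (by norm_num) (by norm_num)
  -- conclusion
  have h := measure_mono (μ := volume) hU.1
  rw [hU.2.2.1] at h
  refine le_trans (le_of_eq ?_) h
  congr 1
  norm_num

/-! ### The filling bound -/

/-- Monotonicity of the Fermi sea in the energy. [folklore] -/
theorem muWinL_fermiSea_mono {μ ν : ℝ} (h : μ ≤ ν) :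
    {p : Momentum | squareDispersion 1 0 p < μ} ∩ brillouinZone ⊆
      {p : Momentum | squareDispersion 1 0 p < ν} ∩ brillouinZone :=
  fun _ hp => ⟨lt_of_lt_of_le hp.1 h, hp.2⟩

/-- The occupied volume at energy `-3/20` is at least `447457/25000`. [folklore] -/
theorem muWinL_le_volume_occupied :
    ENNReal.ofReal (447457 / 25000) ≤
      volume ({p : Momentum | squareDispersion 1 0 p < -(3 : ℝ) / 20} ∩ brillouinZone) := by
  refine muWinL_le_volume_fermiSeaCoord.trans ((volume_fermiSeaCoord_le (3 / 40 : ℝ)).trans ?_)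
  exact measure_mono (muWinL_fermiSea_mono (by norm_num))

/-- **Certified lower filling bound at the upper end of the analysis window**: `n(-3/20) ≥ 9/10`
(`vol ≥ 17.89828 > 1.8 π²`, `π < 3.1416`; true value `n(-0.15) = 0.9138`). [folklore] -/
theorem muWinL_filling_ge :
    (9 : ℝ) / 10 ≤ KohnLuttinger.filling (squareDispersion 1 0) (-(3 : ℝ) / 20) := by
  rw [kl_mu_filling_eq]
  have hV : (447457 : ℝ) / 25000 ≤
      (volume ({p : Momentum | squareDispersion 1 0 p < -(3 : ℝ) / 20} ∩ brillouinZone)).toReal :=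
    (ENNReal.ofReal_le_iff_le_toReal (kl_mu_volume_occupied_lt_top _).ne).1 muWinL_le_volume_occupied
  have hpi := Real.pi_lt_d4
  have hpi0 := Real.pi_pos
  have hpi2 : Real.pi * Real.pi < 3.1416 * 3.1416 := mul_self_lt_mul_self hpi0.le hpi
  rw [le_div_iff₀ (by positivity)]
  nlinarith

end Summit.HubbardSuperconductivity.HubbardSuperconductivity.Theorems

end
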